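import Literature.Probability.RandomPlanarGeometry.HexSAWSurfaceYcFaces
import HarnessLib

/-!
# The half-plane critical surface fugacity of honeycomb SAW, II: the two-cut decomposition of half-plane walks
# (door (c-print) «HEX-YC-PRINT», tree edition file T2 of 3 — face D1 `HalfPlaneCut`)

Topic `Literature/Probability/RandomPlanarGeometry` (continues `HexSAWSurfaceYcFaces.lean` — `HV.stripGFxy`, `HV.hpGF`,
`HV.botContacts`, `HV.sigmaT`; and the tree's `HexSAWBridges.lean` — `HV.lastArgmin`, `HV.lastArgmax`, `HV.sawsUpTo` —,
`HexSAWLowerBound.lean` — `HV.bridgeLists`, `HV.card_filter_inner_eq_le_two`).  Sources and READING AS PRINTED: as in file I.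
The decomposition: a half-plane walk of the box `S_{T,L}` is cut at its LAST surface (level-0) vertex — the tail is a free
self-avoiding walk from one of the two upper neighbours, the final half-edge has at most two choices — and the remaining surface
loop at its LAST DEEPEST vertex into two pieces which, reflected by the level flip `σ_{T',a}` (and padded by one vertex when the
depth is even), are two bridges of ONE strip `S_{T',2L+T}` carrying all the surface contacts as top contacts; whence
`C^+_{T,L}(x,y) ≤ 1 + (2 + 4Z)(xy + 2x⁻³ Σ_{T' ≤ T} b(T')²)` for any bounds `b(T')` on the `β`-class sums and `Z` on the free
tail (`HV.HalfPlaneCut`, `HV.halfPlaneCut_holds`).  This is the route of Hammersley–Welsh 1962 / Duminil-Copin–Smirnov 2012 §3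
("Out of the vertices having the maximal real part, choose the one visited last") with a surface weight, and — for the desorbed
half of `y_c = 1 + √2` — the route of Glazman–Manolescu 2020 §5.4 (arXiv:1708.00395v3 pp. 23–24: "Write γ as the concatenation of
two walks γ^(a) and γ^(w), where γ^(a) ends at the last visit of γ of column 1 … Further split γ^(a) in two walks … two bridges
γ^(b1) and γ^(b2) in S_T(Θ)"); the lane cuts at the LAST deepest visit with an explicit parity pad and explicit constants
(refute-first findings R1–R3 of the design: parity factor, free final half-edge, two cuts suffice).

DESIGN AND AUTHORSHIP.  Statements and proofs are a-idea-1 gen 18's HOME sketch `Sketch_G18_YcPrint.lean` ed.5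
(sha16 08b0d94aa61eee15, 2026-08-23; D1 block = sections `CutA` … `CutD` + `halfPlaneCut_holds`) VERBATIM, moved to the tree
namespace by the filer a-p6 gen 8; the D1 machinery (`listWt`, `hpLists`, `hdP/tlP`, `upNbrs`, `pivot/tOf/padOf/cls/sig/B1/B3`, `bWt`,
and their lemmas) lives in the sub-namespace `…SAW.HV.YcCut`, the face and its proof are `HV.HalfPlaneCut` / `HV.halfPlaneCut_holds`.
File T3 (`HexSAWSurfaceYc.lean`: the desorbed bound, the Hölder transfer and `hexSurfaceYc = 1 + √2`) continues.
-/

noncomputable section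

open Finset Filter Topology

namespace Literature.Probability.RandomPlanarGeometry.SAW.HV

/-! ### The face D1 -/

/-- **D1 «HP-CUT» (the two-cut decomposition, finite form).**  A half-plane walk `γ = (v₀,…,v_{ℓ−1}) ⊂ S_{T,L}` from `a`
(`ℓ ≥ 1`; final half-edge towards `u`, which in `HV.IsMidWalk` is ANY non-retracing neighbour of `v_{ℓ−1}` — inside, outside or
visited — so `hpGF` counts every half-plane walk of the box, ≤ 2 final half-edges each) is cut at its LAST level-0 vertex `v_j`:
the tail `t = (v_{j+1},…,v_{ℓ−1})` is empty or a free SAW from one of the two upper neighbours of `v_j`, and `u` has ≤ 2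
choices, whence the factor `2(1 + 2xz) ≤ 2 + 4z`; the head
`h = γ[0..j]` (a surface loop: from level 0 back to level 0 inside levels `[0, 2T−1]`) is `(v₀)` if its top level `D` is `0`
(term `xy`); else cut `h` at its LAST visit `v_q` to level `D` into `h₁ = γ[0..q]` and `h₃ = γ[q..j]` (the two pieces SHARE
`v_q`, so they decode `h` without ambiguity).  With `T' = ⌈(D+1)/2⌉ ∈ [1,T]` and `σ` = the tree's point reflection `HV.flip`
followed by `HV.shift _ T'` (`lev ↦ 2T'−1−lev` by `lev_flip`/`lev_shift`, an automorphism for EVERY `T'`) and a horizontal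
translation: `σ(h₁)` REVERSED and `σ(h₃)` are walks `a → β` of `S_{T',L'}` (levels `[2T'−1−D, 2T'−1] ⊂ [0, 2T'−1]`; repeated
visits of `h₁` to level `D` become harmless visits to level `2T'−1−D ∈ {0,1}`), after padding one unused level-0 vertex
below the start when `D` is even; the level-0 vertices of `h` become exactly the top contacts of the two images, `ℓ` is
additive up to the ≤ 3 padded/shared vertices (whence `x⁻³` for `x ≤ 1`), and for each parity of `D` the map
`h ↦ (B₁, B₃)` is injective (whence the factor `2`).  Stated with an abstract bound `b` on the `β`-class sums (valid for all
`L'`; `L' = 2L + 4T + 4` suffices) and `c` on free SAW counts, so that no supremum appears.  TEMPLATE: the tree's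
Hammersley–Welsh file `HexSAWBridges` (`hwFst/hwSnd/hw_injOn` = cut at the last visit to the lowest level, `brPart/hsPart` =
cut at the last visit to the highest level with `flip`, `wt_brFin_odd_le/even_le/true_le` + `brFin_subset_bridgeLists` = the
parity padding into `B_{T,L}`), now carrying the weight `y^{#level-0 vertices}`.
[cite: DuminilCopinSmirnov2012, §3, proof of Theorem 1 ("Such decomposition was first introduced by Hammersley and Welsh"; "Out of the vertices having the maximal real part, choose the one visited last", arXiv PDF p. 8); HammersleyWelsh1962; MadrasSlade1993, §3.1 (proof of Theorem 3.1.1, pp. 57–59); BeatonBousquetMelouDeGierDuminilCopinGuttmann2014, §4.5 Fig. 9 (cut at the last contact, arXiv v5 p. 15); GlazmanManolescu2019, §5.4, proof of Theorem 3 (arXiv v3 pp. 23–24: the same two cuts — last visit of column 1, then the deepest column — for the desorbed half)] -/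
def HalfPlaneCut : Prop := ∀ (x y : ℝ), 0 < x → x ≤ 1 → 0 ≤ y → ∀ (b c : ℕ → ℝ) (z : ℝ),
  (∀ T' L' : ℕ, 1 ≤ T' → stripGFxy T' L' (IsBetaDart T') x y ≤ b T') →
  (∀ (v : HV) (m : ℕ), (sawCount hvGraph v m : ℝ) ≤ c m) → (∀ N : ℕ, ∑ m ∈ range N, c m * x ^ m ≤ z) →
  ∀ T L : ℕ, hpGF T L x y ≤ 1 + (2 + 4 * z) * (x * y + 2 * x⁻¹ ^ 3 * ∑ T' ∈ Icc 1 T, b T' * b T')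

namespace YcCut

/-! ### D1, Step A: at most two exits per inner list (`C^+_{T,L} ≤ 1 + 2 Σ_{lists} x^{|l|} y^{#₀ l}`) -/

section CutA

variable {T L : ℕ}

/-- Weight of a vertex list in the half-plane sum: `x^{|l|} y^{#{v ∈ l : lev v = 0}}`. [cite: BeatonBousquetMelouDeGierDuminilCopinGuttmann2014, §3.1 (arXiv v5 pp. 8–9: C⁺_k(y), the half-plane partition function)] -/
def listWt (x y : ℝ) (l : List HV) : ℝ := x ^ l.length * y ^ (l.filter fun v => lev v = 0).length

/-- `listWt ≥ 0` for `x, y ≥ 0`. [cite: BeatonBousquetMelouDeGierDuminilCopinGuttmann2014, §3.1 (arXiv v5 pp. 8–9: C⁺_k(y), the half-plane partition function)] -/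
theorem listWt_nonneg {x y : ℝ} (hx : 0 ≤ x) (hy : 0 ≤ y) (l : List HV) : 0 ≤ listWt x y l :=
  mul_nonneg (pow_nonneg hx _) (pow_nonneg hy _)

/-- The nonempty inner vertex lists of the mid-edge walks of `S_{T,L}` (self-avoiding lists from `O` inside the strip).
[cite: DuminilCopinSmirnov2012, §1 (mid-edge walks = vertex SAW + final half-edge)] -/
def hpLists (T L : ℕ) : Finset (List HV) := ((midWalks (stripV T L)).image inner).erase []

/-- Members of `hpLists` are nonempty self-avoiding vertex lists from `O` inside `S_{T,L}`. [cite: DuminilCopinSmirnov2012, §1] -/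
theorem of_mem_hpLists {l : List HV} (hl : l ∈ hpLists T L) :
    l ≠ [] ∧ l.IsChain hvGraph.Adj ∧ l.head? = some hvOrigin ∧ l.Nodup ∧ ∀ v ∈ l, v ∈ stripV T L := by
  rw [hpLists, mem_erase, mem_image] at hl
  obtain ⟨hne, P, hP, rfl⟩ := hl
  rw [mem_midWalks_iff] at hP
  rcases hP.trivial_or_exists with rfl | ⟨l, u, hl, rfl⟩
  · exact absurd rfl hne
  · rw [inner_cons_append] at hne ⊢
    obtain ⟨hc, hh, -, hV, hnd, -⟩ := (isMidWalk_cons_append_iff _ hl u).1 hP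
    exact ⟨hl, hc, hh, hnd, hV⟩

/-- **Step A**: `C^+_{T,L}(x, y) ≤ 1 + 2 Σ_{l ∈ hpLists} x^{|l|} y^{#₀ l}` — the trivial walk, plus: a nontrivial mid-edge walk is its
inner list and one of AT MOST TWO final half-edges (tree `card_filter_inner_eq_le_two`; refute-first finding R2: the half-edge is free, it
need not point upward). [cite: DuminilCopinSmirnov2012, §1; BeatonBousquetMelouDeGierDuminilCopinGuttmann2014, §3.1 (arXiv v5 pp. 8–9: C⁺_k(y), the half-plane partition function)] -/
theorem hpGF_le_sum_hpLists {x y : ℝ} (hx : 0 ≤ x) (hy : 0 ≤ y) :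
    hpGF T L x y ≤ 1 + 2 * ∑ l ∈ hpLists T L, listWt x y l := by
  classical
  set V := stripV T L
  have htriv : [wOut, hvOrigin] ∈ midWalks V := mem_midWalks_iff.2 (isMidWalk_trivial V)
  rw [hpGF, ← add_sum_erase _ _ htriv, mwLen_trivial, pow_zero]
  have hb0 : botContacts [wOut, hvOrigin] = 0 := by rfl
  rw [hb0, pow_zero, mul_one]
  gcongr 1 + ?_
  set S := (midWalks V).erase [wOut, hvOrigin] with hS
  have hmaps : ∀ P ∈ S, inner P ∈ hpLists T L := by
    intro P hP
    rw [hpLists, mem_erase]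
    refine ⟨fun h0 => ?_, mem_image_of_mem _ (mem_of_mem_erase hP)⟩
    rcases (mem_midWalks_iff.1 (mem_of_mem_erase hP)).trivial_or_exists with hP' | ⟨l, u, hl, hP'⟩
    · exact ne_of_mem_erase hP hP'
    · rw [hP', inner_cons_append] at h0; exact hl h0
  have h1 : ∑ P ∈ S, x ^ mwLen P * y ^ botContacts P = ∑ P ∈ S, listWt x y (inner P) :=
    sum_congr rfl fun P hP => by
      rw [listWt, (mem_midWalks_iff.1 (mem_of_mem_erase hP)).length_inner]; rfl
  rw [h1, ← sum_fiberwise_of_maps_to hmaps, mul_sum]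
  refine sum_le_sum fun l hl => ?_
  obtain ⟨hne, hc, hh, -, -⟩ := of_mem_hpLists hl
  rw [sum_congr rfl fun P hP => by rw [(mem_filter.1 hP).2], sum_const, nsmul_eq_mul]
  refine mul_le_mul_of_nonneg_right ?_ (listWt_nonneg hx hy l)
  have hsub : S.filter (fun P => inner P = l) ⊆ (midWalks V).filter fun P => inner P = l :=
    filter_subset_filter _ (erase_subset _ _)
  exact_mod_cast (card_le_card hsub).trans (card_filter_inner_eq_le_two V hne hc hh)

end CutA

/-! ### D1, Step B: cut at the LAST visit to the surface (tree `lastArgmin`); the tail costs a factor `≤ 1 + 2xZ(x)` -/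

section CutB

variable {T L : ℕ} {l : List HV}

/-- Head piece: the list up to its LAST level-`0` vertex. [cite: BeatonBousquetMelouDeGierDuminilCopinGuttmann2014, §4.5 (arXiv v5 p. 15: "By looking at its last contact, one can factor the arch into two bridges", Fig. 11, eq. (20)); GlazmanManolescu2019, §5.4, proof of Theorem 3 (arXiv v3 pp. 23–24); DuminilCopinSmirnov2012, §3] -/
def hdP (l : List HV) : List HV := l.take (lastArgmin l + 1)

/-- Tail piece: after the last level-`0` vertex (it never returns to the surface). [cite: BeatonBousquetMelouDeGierDuminilCopinGuttmann2014, §4.5 (arXiv v5 p. 15: "By looking at its last contact, one can factor the arch into two bridges", Fig. 11, eq. (20))] -/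
def tlP (l : List HV) : List HV := l.drop (lastArgmin l + 1)

/-- `l = hdP l ++ tlP l` (the cut at the last surface visit loses nothing). [cite: BeatonBousquetMelouDeGierDuminilCopinGuttmann2014, §4.5 (arXiv v5 p. 15: "By looking at its last contact, one can factor the arch into two bridges", Fig. 11, eq. (20)); GlazmanManolescu2019, §5.4, proof of Theorem 3 (arXiv v3 pp. 23–24)] -/
theorem hdP_append_tlP (l : List HV) : hdP l ++ tlP l = l := List.take_append_drop _ _

/-- The two upper neighbours of the surface vertex `(a, 0, ∘)` (its third neighbour is below the surface). [folklore] -/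
def upNbrs (a : ℤ) : Finset HV := {(a, 0, true), (a - 1, 0, true)}

/-- `#upNbrs ≤ 2` (two upper neighbours of a surface vertex). [cite: GlazmanManolescu2019, §5.4, proof of Theorem 3 (arXiv v3 pp. 23–24); DuminilCopinSmirnov2012, §1] -/
theorem card_upNbrs_le (a : ℤ) : (upNbrs a).card ≤ 2 := by
  rw [upNbrs]; exact (card_insert_le _ _).trans (by simp)

/-- Splitting a weight at a tail with no surface vertex. [cite: BeatonBousquetMelouDeGierDuminilCopinGuttmann2014, §3.1 (arXiv v5 pp. 8–9: C⁺_k(y), the half-plane partition function); GlazmanManolescu2019, §5.4, proof of Theorem 3 (arXiv v3 pp. 23–24)] -/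
theorem listWt_append_of_filter_nil (x y : ℝ) {h t : List HV} (ht : t.filter (fun v => lev v = 0) = []) :
    listWt x y (h ++ t) = listWt x y h * x ^ t.length := by
  rw [listWt, listWt, List.length_append, List.filter_append, ht, List.append_nil, pow_add]; ring

/-- On `hpLists` the last minimal-level vertex is on the surface and everything after it is strictly above.
[cite: DuminilCopinSmirnov2012, §3] -/
theorem lev_lastArgmin_eq_zero (hl : l ∈ hpLists T L) :
    ∃ hm : lastArgmin l < l.length, lev l[lastArgmin l] = 0 ∧
      ∀ (j : ℕ) (hj : j < l.length), lastArgmin l < j → 0 < lev l[j] := by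
  obtain ⟨hne, hc, hh, hnd, hV⟩ := of_mem_hpLists hl
  obtain ⟨hm, hmin, hstrict⟩ := lastArgmin_spec hne
  have h0 : l[0]'(List.length_pos_of_ne_nil hne) = hvOrigin := by
    rw [List.head?_eq_getElem?, List.getElem?_eq_getElem (List.length_pos_of_ne_nil hne)] at hh
    exact Option.some_inj.1 hh
  have hge : 0 ≤ lev l[lastArgmin l] := (lev_mem_of_mem_stripV (hV _ (List.getElem_mem _))).1
  have hle := hmin 0 (List.length_pos_of_ne_nil hne)
  rw [h0, lev_hvOrigin] at hle
  have heq : lev l[lastArgmin l] = 0 := le_antisymm hle hge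
  exact ⟨hm, heq, fun j hj hlt => by have := hstrict j hj hlt; omega⟩

/-- The tail carries no surface weight. [cite: BeatonBousquetMelouDeGierDuminilCopinGuttmann2014, §4.5 (arXiv v5 p. 15: "By looking at its last contact, one can factor the arch into two bridges", Fig. 11, eq. (20))] -/
theorem filter_tlP_eq_nil (hl : l ∈ hpLists T L) : (tlP l).filter (fun v => lev v = 0) = [] := by
  obtain ⟨hm, -, hpos⟩ := lev_lastArgmin_eq_zero hl
  rw [List.filter_eq_nil_iff]
  intro v hv
  rw [tlP, List.mem_iff_getElem] at hv
  obtain ⟨i, hi, rfl⟩ := hv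
  rw [List.length_drop] at hi
  rw [List.getElem_drop]
  have := hpos (lastArgmin l + 1 + i) (by omega) (by omega)
  simp only [decide_eq_true_eq]; omega

/-- `wt(l) = wt(hdP l) · x^{|tlP l|}`. [cite: BeatonBousquetMelouDeGierDuminilCopinGuttmann2014, §4.5 (arXiv v5 p. 15: "By looking at its last contact, one can factor the arch into two bridges", Fig. 11, eq. (20))] -/
theorem listWt_eq_hdP_tlP (hl : l ∈ hpLists T L) (x y : ℝ) :
    listWt x y l = listWt x y (hdP l) * x ^ (tlP l).length := by
  conv_lhs => rw [← hdP_append_tlP l]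
  exact listWt_append_of_filter_nil x y (filter_tlP_eq_nil hl)

/-- The head piece ends at a surface vertex `(a, 0, ∘)`. [cite: DuminilCopinSmirnov2012, §3] -/
theorem hdP_getLast? (hl : l ∈ hpLists T L) : ∃ a : ℤ, (hdP l).getLast? = some (a, 0, false) := by
  obtain ⟨hne, hc, hh, hnd, hV⟩ := of_mem_hpLists hl
  obtain ⟨hm, h0, -⟩ := lev_lastArgmin_eq_zero hl
  have e : (hdP l).getLast? = some l[lastArgmin l] := by
    rw [hdP, List.getLast?_eq_getElem?, List.length_take, Nat.min_eq_left (by omega), Nat.add_sub_cancel,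
      List.getElem?_take_of_lt (by omega), List.getElem?_eq_getElem hm]
  rcases hv : l[lastArgmin l] with ⟨a, b, c⟩
  rw [hv] at h0 e
  refine ⟨a, ?_⟩
  rw [e]
  have hb : b = 0 := by cases c <;> simp [lev, bit] at h0 <;> omega
  have hc' : c = false := by
    cases c
    · rfl
    · simp [lev, bit] at h0; omega
  subst hb; subst hc'; rfl

/-- A nonempty tail starts at one of the TWO upper neighbours of the last surface vertex and is a self-avoiding list of fewer than
`|S_{T,L}|` vertices. [cite: DuminilCopinSmirnov2012, §1; BeatonBousquetMelouDeGierDuminilCopinGuttmann2014, §3.1 (arXiv v5 pp. 8–9: C⁺_k(y), the half-plane partition function)] -/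
theorem tlP_mem_biUnion (hl : l ∈ hpLists T L) {a : ℤ} (ha : (hdP l).getLast? = some (a, 0, false)) (ht : tlP l ≠ []) :
    ∃ w ∈ upNbrs a, tlP l ∈ (range (stripV T L).card).biUnion fun n => sawFin w n := by
  obtain ⟨hne, hc, hh, hnd, hV⟩ := of_mem_hpLists hl
  obtain ⟨hm, h0, hpos⟩ := lev_lastArgmin_eq_zero hl
  have hlt : lastArgmin l + 1 < l.length := by
    by_contra hge; apply ht; rw [tlP, List.drop_eq_nil_iff]; omega
  have hlm : l[lastArgmin l] = (a, 0, false) := by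
    have e : (hdP l).getLast? = some l[lastArgmin l] := by
      rw [hdP, List.getLast?_eq_getElem?, List.length_take, Nat.min_eq_left (by omega), Nat.add_sub_cancel,
        List.getElem?_take_of_lt (by omega), List.getElem?_eq_getElem hm]
    rw [e] at ha
    exact Option.some_inj.1 ha
  have hadj : hvGraph.Adj l[lastArgmin l] l[lastArgmin l + 1] := hc.getElem _ hlt
  have hwV : l[lastArgmin l + 1] ∈ stripV T L := hV _ (List.getElem_mem _)
  have hlevw := (lev_mem_of_mem_stripV hwV).1
  refine ⟨l[lastArgmin l + 1], ?_, ?_⟩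
  · rw [hlm, hvGraph_adj_iff_mem_nbrs] at hadj
    simp only [nbrs, List.mem_cons, List.not_mem_nil, or_false] at hadj
    rw [upNbrs, mem_insert, mem_singleton]
    rcases hadj with h | h | h
    · exact Or.inl h
    · exact Or.inr h
    · exfalso; rw [h] at hlevw; simp [lev, bit] at hlevw
  · rw [mem_biUnion]
    refine ⟨(tlP l).length - 1, ?_, ?_⟩
    · rw [mem_range]
      have hlen : l.length ≤ (stripV T L).card := by
        rw [← List.toFinset_card_of_nodup hnd]; exact card_le_card fun v hv => hV v (List.mem_toFinset.1 hv)
      rw [tlP, List.length_drop]; omega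
    · rw [mem_sawFin_iff, mem_sawLists_iff]
      refine ⟨hc.drop _, ?_, ?_, hnd.sublist (List.drop_sublist _ _)⟩
      · rw [tlP, List.head?_drop, List.getElem?_eq_getElem hlt]
      · have : 0 < (tlP l).length := List.length_pos_of_ne_nil ht
        omega

/-- Sum over a union of two finsets of nonnegative reals (bookkeeping for the two upper neighbours). [cite: GlazmanManolescu2019, §5.4, proof of Theorem 3 (arXiv v3 pp. 23–24)] -/
theorem sum_union_le_add {ι : Type*} [DecidableEq ι] {s t : Finset ι} {f : ι → ℝ} (hf : ∀ i ∈ s, 0 ≤ f i) :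
    ∑ i ∈ s ∪ t, f i ≤ ∑ i ∈ s, f i + ∑ i ∈ t, f i := by
  rw [← sum_union_inter]
  exact le_add_of_nonneg_right (sum_nonneg fun i hi => hf i (mem_inter.1 hi).1)

/-- **The self-avoiding lists from a fixed vertex with fewer than `N` vertices weigh at most `x · Σ_{m<N} c_m x^m ≤ x z`.**
[cite: MadrasSlade1993, §1.2 (c_n); DuminilCopinSmirnov2012, §1 (Z(x))] -/
theorem sum_biUnion_sawFin_le {x : ℝ} (hx : 0 ≤ x) (c : ℕ → ℝ) (z : ℝ)
    (hc : ∀ (v : HV) (m : ℕ), (sawCount hvGraph v m : ℝ) ≤ c m) (hz : ∀ N : ℕ, ∑ m ∈ range N, c m * x ^ m ≤ z)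
    (w : HV) (N : ℕ) : ∑ t ∈ (range N).biUnion (fun n => sawFin w n), x ^ t.length ≤ x * z := by
  rw [sum_biUnion]
  · calc ∑ n ∈ range N, ∑ t ∈ sawFin w n, x ^ t.length
          = ∑ n ∈ range N, ((sawFin w n).card : ℝ) * x ^ (n + 1) := by
            refine sum_congr rfl fun n _ => ?_
            rw [sum_congr rfl fun t ht => by rw [(mem_sawLists_iff.1 (mem_sawFin_iff.1 ht)).2.2.1], sum_const, nsmul_eq_mul]
        _ ≤ ∑ n ∈ range N, c n * x ^ (n + 1) := by
            refine sum_le_sum fun n _ => mul_le_mul_of_nonneg_right ?_ (pow_nonneg hx _)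
            have := hc w n
            rwa [sawCount_eq_ncard_sawLists, ncard_sawLists_eq_card_sawFin] at this
        _ = x * ∑ n ∈ range N, c n * x ^ n := by
            rw [mul_sum]; exact sum_congr rfl fun n _ => by rw [pow_succ]; ring
        _ ≤ x * z := mul_le_mul_of_nonneg_left (hz N) hx
  · intro n _ m _ hnm
    simp only [Function.onFun, disjoint_left]
    intro t ht ht'
    have h1 := (mem_sawLists_iff.1 (mem_sawFin_iff.1 ht)).2.2.1
    have h2 := (mem_sawLists_iff.1 (mem_sawFin_iff.1 ht')).2.2.1
    exact hnm (by omega)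

/-- **The tails over a fixed head weigh at most `1 + 2xz`**: the empty tail, or a self-avoiding list from one of the two upper
neighbours of the last surface vertex. [cite: BeatonBousquetMelouDeGierDuminilCopinGuttmann2014, §4.5 (arXiv v5 p. 15: "By looking at its last contact, one can factor the arch into two bridges", Fig. 11, eq. (20)); DuminilCopinSmirnov2012, §1] -/
theorem sum_fiber_tails_le {x : ℝ} (hx : 0 ≤ x) (c : ℕ → ℝ) (z : ℝ)
    (hc : ∀ (v : HV) (m : ℕ), (sawCount hvGraph v m : ℝ) ≤ c m) (hz : ∀ N : ℕ, ∑ m ∈ range N, c m * x ^ m ≤ z)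
    {l₀ : List HV} (hl₀ : l₀ ∈ hpLists T L) :
    ∑ l ∈ (hpLists T L).filter (fun l => hdP l = hdP l₀), x ^ (tlP l).length ≤ 1 + 2 * x * z := by
  classical
  obtain ⟨a, ha⟩ := hdP_getLast? hl₀
  set N := (stripV T L).card
  set B : HV → Finset (List HV) := fun w => (range N).biUnion fun n => sawFin w n with hB
  set Tt : Finset (List HV) := {[]} ∪ (B (a, 0, true) ∪ B (a - 1, 0, true)) with hTt
  have hmaps : ∀ l ∈ (hpLists T L).filter (fun l => hdP l = hdP l₀), tlP l ∈ Tt := by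
    intro l hl
    obtain ⟨hlS, hEq⟩ := mem_filter.1 hl
    rw [hTt, mem_union, mem_singleton, mem_union]
    by_cases ht : tlP l = []
    · exact Or.inl ht
    · obtain ⟨w, hw, hmem⟩ := tlP_mem_biUnion hlS (by rw [hEq]; exact ha) ht
      rw [upNbrs, mem_insert, mem_singleton] at hw
      rcases hw with rfl | rfl
      · exact Or.inr (Or.inl hmem)
      · exact Or.inr (Or.inr hmem)
  have hinj : Set.InjOn tlP ((hpLists T L).filter (fun l => hdP l = hdP l₀) : Finset (List HV)) := by
    intro l hl l' hl' h
    rw [Finset.mem_coe, mem_filter] at hl hl'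
    rw [← hdP_append_tlP l, ← hdP_append_tlP l', hl.2, hl'.2, h]
  have hnn : ∀ t : List HV, 0 ≤ x ^ t.length := fun t => pow_nonneg hx _
  calc ∑ l ∈ (hpLists T L).filter (fun l => hdP l = hdP l₀), x ^ (tlP l).length
      ≤ ∑ t ∈ Tt, x ^ t.length := sum_le_sum_of_injOn_of_nonneg tlP hinj hmaps (fun t => x ^ t.length) fun t _ => hnn t
    _ ≤ ∑ t ∈ ({[]} : Finset (List HV)), x ^ t.length + ∑ t ∈ B (a, 0, true) ∪ B (a - 1, 0, true), x ^ t.length :=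
        sum_union_le_add fun t _ => hnn t
    _ ≤ 1 + (∑ t ∈ B (a, 0, true), x ^ t.length + ∑ t ∈ B (a - 1, 0, true), x ^ t.length) := by
        rw [sum_singleton, List.length_nil, pow_zero]
        have := sum_union_le_add (s := B (a, 0, true)) (t := B (a - 1, 0, true)) (f := fun t => x ^ t.length) fun t _ => hnn t
        linarith
    _ ≤ 1 + (x * z + x * z) := by
        have h1 := sum_biUnion_sawFin_le hx c z hc hz (a, 0, true) N
        have h2 := sum_biUnion_sawFin_le hx c z hc hz (a - 1, 0, true) N
        linarith
    _ = 1 + 2 * x * z := by ring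

/-- **Step B**: `Σ_{l ∈ hpLists} wt(l) ≤ (1 + 2xz) · Σ_{h ∈ heads} wt(h)`, heads = the lists ending at their last surface vertex.
[cite: BeatonBousquetMelouDeGierDuminilCopinGuttmann2014, §4.5 (arXiv v5 p. 15: "By looking at its last contact, one can factor the arch into two bridges", Fig. 11, eq. (20)); GlazmanManolescu2019, §5.4, proof of Theorem 3 (arXiv v3 pp. 23–24)] -/
theorem sum_hpLists_le_heads {x y : ℝ} (hx : 0 ≤ x) (hy : 0 ≤ y) (c : ℕ → ℝ) (z : ℝ)
    (hc : ∀ (v : HV) (m : ℕ), (sawCount hvGraph v m : ℝ) ≤ c m) (hz : ∀ N : ℕ, ∑ m ∈ range N, c m * x ^ m ≤ z) :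
    ∑ l ∈ hpLists T L, listWt x y l ≤ (1 + 2 * x * z) * ∑ h ∈ (hpLists T L).image hdP, listWt x y h := by
  classical
  rw [← sum_fiberwise_of_maps_to (g := hdP) (fun l hl => mem_image_of_mem hdP hl), mul_sum]
  refine sum_le_sum fun h hh => ?_
  obtain ⟨l₀, hl₀, rfl⟩ := mem_image.1 hh
  calc ∑ l ∈ (hpLists T L).filter (fun l => hdP l = hdP l₀), listWt x y l
      = ∑ l ∈ (hpLists T L).filter (fun l => hdP l = hdP l₀), listWt x y (hdP l₀) * x ^ (tlP l).length :=
        sum_congr rfl fun l hl => by obtain ⟨hlS, hEq⟩ := mem_filter.1 hl; rw [listWt_eq_hdP_tlP hlS, hEq]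
    _ = listWt x y (hdP l₀) * ∑ l ∈ (hpLists T L).filter (fun l => hdP l = hdP l₀), x ^ (tlP l).length := by rw [mul_sum]
    _ ≤ listWt x y (hdP l₀) * (1 + 2 * x * z) :=
        mul_le_mul_of_nonneg_left (sum_fiber_tails_le hx c z hc hz hl₀) (listWt_nonneg hx hy _)
    _ = (1 + 2 * x * z) * listWt x y (hdP l₀) := mul_comm _ _

end CutB

/-! ### D1, Step C: cut a head at its LAST DEEPEST vertex (tree `lastArgmax`) into two reflected bridges of `S_{T',2L+T}` -/

section CutC

variable {T L : ℕ} {h : List HV}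

/-- The heads: members of `hpLists.image hdP` are nonempty self-avoiding lists from `O` in `S_{T,L}` ENDING ON THE SURFACE.
[cite: BeatonBousquetMelouDeGierDuminilCopinGuttmann2014, §4.5 (arXiv v5 p. 15: "By looking at its last contact, one can factor the arch into two bridges", Fig. 11, eq. (20))] -/
theorem of_mem_heads (hh : h ∈ (hpLists T L).image hdP) :
    h.IsChain hvGraph.Adj ∧ h.head? = some hvOrigin ∧ h.Nodup ∧ (∀ v ∈ h, v ∈ stripV T L) ∧
      ∃ hne : h ≠ [], lev (h.getLast hne) = 0 := by
  obtain ⟨l, hl, rfl⟩ := mem_image.1 hh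
  obtain ⟨hne, hc, hh0, hnd, hV⟩ := of_mem_hpLists hl
  obtain ⟨hm, h0, -⟩ := lev_lastArgmin_eq_zero hl
  have hne' : hdP l ≠ [] := by rw [hdP]; simp [hne]
  refine ⟨hc.take _, by rw [hdP, List.head?_take]; simpa using hh0, hnd.sublist (List.take_sublist _ _),
    fun v hv => hV v (List.mem_of_mem_take hv), hne', ?_⟩
  have e : (hdP l).getLast? = some l[lastArgmin l] := by
    rw [hdP, List.getLast?_eq_getElem?, List.length_take, Nat.min_eq_left (by omega), Nat.add_sub_cancel,
      List.getElem?_take_of_lt (by omega), List.getElem?_eq_getElem hm]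
  rw [List.getLast?_eq_some_getLast hne', Option.some_inj] at e
  rw [e, h0]

/-- The pivot: the LAST vertex of maximal level (tree `lastArgmax`). [cite: DuminilCopinSmirnov2012, §3 ("choose the one visited last")] -/
def pivot (h : List HV) : HV := h.getD (lastArgmax h) hvOrigin

/-- The strip width `T' = ⌈(D+1)/2⌉` of the two pieces, read off the pivot `(p, T'−1, c)` (`D = 2T'−1` if `c`, `2T'−2` if not).
[cite: BeatonBousquetMelouDeGierDuminilCopinGuttmann2014, §3.2, above Corollary 8 (arXiv v5 p. 12: "the analogous series A_T(x;y) and B_T(x;y) that count arches and bridges")] -/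
def tOf (h : List HV) : ℕ := (pivot h).2.1.toNat + 1

/-- The parity pad: when the deepest level `D` is EVEN the reflected pivot sits on level `1` and the piece is completed to a bridge by the
extra vertex `O` below it (refute-first finding R1: the parity factor 2). [cite: DuminilCopinSmirnov2012, §3] -/
def padOf (h : List HV) : List HV := if (pivot h).2.2 then [] else [hvOrigin]

/-- The class `(T', parity)` of a head. [folklore] -/
def cls (h : List HV) : ℕ × Bool := (tOf h, (pivot h).2.2)

/-- The reflection used on both pieces: `σ_{T', p}` with `p` the pivot's abscissa (so the pivot goes to `(0,0,·)`).
[cite: BeatonBousquetMelouDeGierDuminilCopinGuttmann2014, Prop. 6 (arXiv v5 p. 10)] -/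
def sig (h : List HV) : hvGraph ≃g hvGraph := sigmaT (tOf h) (pivot h).1

/-- **First piece** `B₁(h)`: the initial segment `O … pivot`, reversed and reflected (pivot ↦ bottom, `O` ↦ top level), padded.
[cite: BeatonBousquetMelouDeGierDuminilCopinGuttmann2014, §4.5 (arXiv v5 p. 15: "By looking at its last contact, one can factor the arch into two bridges", Fig. 11, eq. (20)); DuminilCopinSmirnov2012, §3 (bridge decomposition)] -/
def B1 (h : List HV) : List HV := padOf h ++ ((h.take (lastArgmax h + 1)).reverse).map (sig h)

/-- **Second piece** `B₃(h)`: the final segment `pivot … last surface vertex`, reflected (pivot ↦ bottom, surface ↦ top level), padded.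
[cite: BeatonBousquetMelouDeGierDuminilCopinGuttmann2014, §4.5 (arXiv v5 p. 15: "By looking at its last contact, one can factor the arch into two bridges", Fig. 11, eq. (20)); DuminilCopinSmirnov2012, §3 (proof of Theorem 1, arXiv PDF p. 8)] -/
def B3 (h : List HV) : List HV := padOf h ++ (h.drop (lastArgmax h)).map (sig h)

/-- Pivot facts for a head with at least two vertices: index, depth `1 ≤ D ≤ 2T−1`, maximality, strictness after the pivot.
[cite: DuminilCopinSmirnov2012, §3] -/
theorem pivot_facts (hh : h ∈ (hpLists T L).image hdP) (h2 : 2 ≤ h.length) :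
    ∃ hq : lastArgmax h < h.length, pivot h = h[lastArgmax h] ∧ pivot h ∈ stripV T L ∧ 0 ≤ (pivot h).2.1 ∧
      (pivot h).2.1 + 1 ≤ T ∧ 1 ≤ lev (pivot h) ∧ (∀ (j : ℕ) (hj : j < h.length), lev h[j] ≤ lev (pivot h)) ∧
      ∀ (j : ℕ) (hj : j < h.length), lastArgmax h < j → lev h[j] < lev (pivot h) := by
  obtain ⟨hc, hh0, hnd, hV, hne, -⟩ := of_mem_heads hh
  obtain ⟨hq, hmax, hstrict⟩ := lastArgmax_spec hne
  have hpiv : pivot h = h[lastArgmax h] := getD_eq_getElem' hq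
  have hmem : pivot h ∈ stripV T L := by rw [hpiv]; exact hV _ (List.getElem_mem _)
  have hbox := mem_stripV_iff.1 hmem
  have hlv := lev_mem_of_mem_stripV hmem
  have h0 : h[0]'(by omega) = hvOrigin := by
    rw [List.head?_eq_getElem?, List.getElem?_eq_getElem (by omega)] at hh0; exact Option.some_inj.1 hh0
  have h1 : lev (h[1]'(by omega)) = 1 := by
    have hadj : hvGraph.Adj (h[0]'(by omega)) (h[1]'(by omega)) := hc.getElem 0 (by omega)
    have hl := lev_eq_of_adj hadj
    rw [h0, lev_hvOrigin] at hl
    have := (lev_mem_of_mem_stripV (hV _ (List.getElem_mem (by omega : 1 < h.length)))).1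
    omega
  refine ⟨hq, hpiv, hmem, hbox.1, ?_, ?_, fun j hj => hpiv ▸ hmax j hj, fun j hj hlt => hpiv ▸ hstrict j hj hlt⟩
  · rcases hp : pivot h with ⟨p, b, c⟩
    rw [hp] at hlv hbox
    cases c <;> simp [lev, bit] at hlv hbox ⊢ <;> omega
  · have := hmax 1 (by omega); rw [h1] at this; rw [hpiv]; exact this

/-- `1 ≤ T'` (the strip of the reflected pieces is nondegenerate). [cite: DuminilCopinSmirnov2012, §3, proof of Theorem 1 (bridge decomposition at the last extremal vertex, arXiv PDF p. 8)] -/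
theorem one_le_tOf (h : List HV) : 1 ≤ tOf h := by rw [tOf]; omega

/-- The reflection sends strip vertices no deeper than the pivot into `S_{T', 2L+T}`. [cite: BeatonBousquetMelouDeGierDuminilCopinGuttmann2014, §4.5 (arXiv v5 p. 15: "By looking at its last contact, one can factor the arch into two bridges", Fig. 11, eq. (20))] -/
theorem sig_mem_stripV (hh : h ∈ (hpLists T L).image hdP) (h2 : 2 ≤ h.length) {v : HV} (hv : v ∈ stripV T L)
    (hle : lev v ≤ lev (pivot h)) : sig h v ∈ stripV (tOf h) (2 * L + T) := by
  obtain ⟨-, -, hmem, hb0, hbT, -, -, -⟩ := pivot_facts hh h2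
  have hT' : ((tOf h : ℕ) : ℤ) = (pivot h).2.1 + 1 := by simp [tOf, Int.toNat_of_nonneg hb0]
  rw [mem_stripV_iff] at hmem hv ⊢
  rw [sig, sigmaT_apply]
  simp only [lev, bit] at hle hmem hv ⊢
  rw [hT']
  rcases hp : pivot h with ⟨p, b, c⟩
  rw [hp] at hle hmem hb0 hbT
  obtain ⟨a, d, e⟩ := v
  cases c <;> cases e <;> simp at hle hmem hv hb0 hbT ⊢ <;> omega

/-- The reflection sends the pivot to `(0, 0, ¬c)`. [cite: BeatonBousquetMelouDeGierDuminilCopinGuttmann2014, Prop. 6 ("by the symmetry of bridges", arXiv v5 p. 10); DuminilCopinSmirnov2012, §3, proof of Theorem 1 (bridge decomposition at the last extremal vertex, arXiv PDF p. 8)] -/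
theorem sig_pivot (hh : h ∈ (hpLists T L).image hdP) (h2 : 2 ≤ h.length) :
    sig h (pivot h) = (0, 0, !(pivot h).2.2) := by
  obtain ⟨-, -, -, hb0, -⟩ := pivot_facts hh h2
  have hT' : ((tOf h : ℕ) : ℤ) = (pivot h).2.1 + 1 := by simp [tOf, Int.toNat_of_nonneg hb0]
  rw [sig, sigmaT_apply, hT']
  refine Prod.ext (by simp) (Prod.ext (by simp) rfl)

/-- Levels under the reflection: `lev (σ v) = 2T'−1 − lev v = 2b + 1 − lev v`. [cite: BeatonBousquetMelouDeGierDuminilCopinGuttmann2014, Prop. 6 ("by the symmetry of bridges", arXiv v5 p. 10)] -/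
theorem lev_sig (hh : h ∈ (hpLists T L).image hdP) (h2 : 2 ≤ h.length) (v : HV) :
    lev (sig h v) = 2 * (pivot h).2.1 + 1 - lev v := by
  obtain ⟨-, -, -, hb0, -⟩ := pivot_facts hh h2
  have hT' : ((tOf h : ℕ) : ℤ) = (pivot h).2.1 + 1 := by simp [tOf, Int.toNat_of_nonneg hb0]
  rw [sig, lev_sigmaT, hT']; ring

/-- A padded reflected piece is a bridge: generic closing step for `B₁`, `B₃`. [cite: DuminilCopinSmirnov2012, §3 (bridges of S_T)] -/
theorem pad_mem_bridgeLists {T' L' : ℕ} (hT' : 1 ≤ T') (c : Bool) {M : List HV} (hM : M ≠ [])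
    (hc : M.IsChain hvGraph.Adj) (hnd : M.Nodup) (hhd : M.head? = some (0, 0, !c))
    (hV : ∀ v ∈ M, v ∈ stripV T' L') (hlev : c = false → ∀ v ∈ M, 1 ≤ lev v)
    (hlast : lev (M.getLast hM) = 2 * (T' : ℤ) - 1) :
    (if c then [] else [hvOrigin]) ++ M ∈ bridgeLists T' L' := by
  rw [mem_bridgeLists_iff hT']
  cases c
  · simp only [Bool.false_eq_true, ↓reduceIte, List.singleton_append]
    obtain ⟨m, M', rfl⟩ := List.exists_cons_of_ne_nil hM
    simp only [List.head?_cons, Option.some.injEq, Bool.not_false] at hhd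
    subst hhd
    refine ⟨?_, rfl, ?_, ?_, List.cons_ne_nil _ _, ?_⟩
    · refine List.isChain_cons_cons.2 ⟨?_, hc⟩
      rw [hvGraph_adj_iff_mem_nbrs]; simp [nbrs, hvOrigin]
    · refine List.nodup_cons.2 ⟨fun hO => ?_, hnd⟩
      have := hlev rfl _ hO
      rw [lev_hvOrigin] at this; omega
    · intro v hv
      rcases List.mem_cons.1 hv with rfl | hv
      · exact hvOrigin_mem_stripV hT'
      · exact hV v hv
    · rw [List.getLast_cons hM]; exact hlast
  · simp only [↓reduceIte, List.nil_append]
    exact ⟨hc, by rw [hhd]; rfl, hnd, hV, hM, hlast⟩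

/-- **`B₃(h)` is a bridge of `S_{T', 2L+T}`.** [cite: BeatonBousquetMelouDeGierDuminilCopinGuttmann2014, §4.5 (arXiv v5 p. 15: "By looking at its last contact, one can factor the arch into two bridges", Fig. 11, eq. (20)); DuminilCopinSmirnov2012, §3 (proof of Theorem 1, arXiv PDF p. 8)] -/
theorem B3_mem (hh : h ∈ (hpLists T L).image hdP) (h2 : 2 ≤ h.length) : B3 h ∈ bridgeLists (tOf h) (2 * L + T) := by
  obtain ⟨hc, hh0, hnd, hV, hne, hlast⟩ := of_mem_heads hh
  obtain ⟨hq, hpiv, hmem, hb0, hbT, hD1, hmax, -⟩ := pivot_facts hh h2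
  have hσq := sig_pivot hh h2
  set M := (h.drop (lastArgmax h)).map (sig h) with hM
  have hMne : M ≠ [] := by rw [hM]; simp [List.drop_eq_nil_iff]; omega
  have hB : B3 h = (if (pivot h).2.2 then [] else [hvOrigin]) ++ M := rfl
  rw [hB]
  refine pad_mem_bridgeLists (one_le_tOf h) _ hMne ?_ ?_ ?_ ?_ ?_ ?_
  · rw [hM, List.isChain_map]
    exact (hc.drop _).imp fun u v (huv : hvGraph.Adj u v) => (sig h).map_rel_iff.2 huv
  · exact (hnd.sublist (List.drop_sublist _ _)).map (sig h).injective
  · rw [hM, List.head?_map, List.head?_drop, List.getElem?_eq_getElem hq, Option.map_some, ← hpiv, hσq]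
  · intro v hv
    rw [hM, List.mem_map] at hv
    obtain ⟨u, hu, rfl⟩ := hv
    obtain ⟨j, hj, rfl⟩ := List.getElem_of_mem (List.mem_of_mem_drop hu)
    exact sig_mem_stripV hh h2 (hV _ (List.getElem_mem _)) (hmax j hj)
  · intro hcF v hv
    rw [hM, List.mem_map] at hv
    obtain ⟨u, hu, rfl⟩ := hv
    obtain ⟨j, hj, rfl⟩ := List.getElem_of_mem (List.mem_of_mem_drop hu)
    rw [lev_sig hh h2]
    have h1 := hmax j hj
    have hD : lev (pivot h) = 2 * (pivot h).2.1 := by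
      rcases hp : pivot h with ⟨p, b, c⟩
      rw [hp] at hcF
      simp only at hcF; subst hcF; simp [lev, bit]
    omega
  · have e : M.getLast? = some (sig h (h.getLast hne)) := by
      rw [hM, List.getLast?_map, List.getLast?_drop, if_neg (by omega), List.getLast?_eq_some_getLast hne, Option.map_some]
    rw [List.getLast?_eq_some_getLast hMne, Option.some_inj] at e
    rw [e, lev_sig hh h2, hlast]
    have hT' : ((tOf h : ℕ) : ℤ) = (pivot h).2.1 + 1 := by simp [tOf, Int.toNat_of_nonneg hb0]
    rw [hT']; ring

/-- **`B₁(h)` is a bridge of `S_{T', 2L+T}`.** [cite: BeatonBousquetMelouDeGierDuminilCopinGuttmann2014, §4.5 (arXiv v5 p. 15: "By looking at its last contact, one can factor the arch into two bridges", Fig. 11, eq. (20)); DuminilCopinSmirnov2012, §3 (proof of Theorem 1, arXiv PDF p. 8)] -/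
theorem B1_mem (hh : h ∈ (hpLists T L).image hdP) (h2 : 2 ≤ h.length) : B1 h ∈ bridgeLists (tOf h) (2 * L + T) := by
  obtain ⟨hc, hh0, hnd, hV, hne, -⟩ := of_mem_heads hh
  obtain ⟨hq, hpiv, hmem, hb0, hbT, hD1, hmax, -⟩ := pivot_facts hh h2
  have hσq := sig_pivot hh h2
  set M := ((h.take (lastArgmax h + 1)).reverse).map (sig h) with hM
  have htk : h.take (lastArgmax h + 1) ≠ [] := by simp [hne]
  have hMne : M ≠ [] := by rw [hM]; simpa using htk
  have hB : B1 h = (if (pivot h).2.2 then [] else [hvOrigin]) ++ M := rfl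
  have etk : (h.take (lastArgmax h + 1)).getLast? = some h[lastArgmax h] := by
    rw [List.getLast?_eq_getElem?, List.length_take, Nat.min_eq_left (by omega), Nat.add_sub_cancel,
      List.getElem?_take_of_lt (by omega), List.getElem?_eq_getElem hq]
  rw [hB]
  refine pad_mem_bridgeLists (one_le_tOf h) _ hMne ?_ ?_ ?_ ?_ ?_ ?_
  · rw [hM, List.isChain_map, List.isChain_reverse]
    exact (hc.take _).imp fun u v (huv : hvGraph.Adj u v) => ((sig h).map_rel_iff.2 huv).symm
  · exact (List.nodup_reverse.2 (hnd.sublist (List.take_sublist _ _))).map (sig h).injective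
  · rw [hM, List.head?_map, List.head?_reverse, etk, Option.map_some, ← hpiv, hσq]
  · intro v hv
    rw [hM, List.mem_map] at hv
    obtain ⟨u, hu, rfl⟩ := hv
    rw [List.mem_reverse] at hu
    obtain ⟨j, hj, rfl⟩ := List.getElem_of_mem (List.mem_of_mem_take hu)
    exact sig_mem_stripV hh h2 (hV _ (List.getElem_mem _)) (hmax j hj)
  · intro hcF v hv
    rw [hM, List.mem_map] at hv
    obtain ⟨u, hu, rfl⟩ := hv
    rw [List.mem_reverse] at hu
    obtain ⟨j, hj, rfl⟩ := List.getElem_of_mem (List.mem_of_mem_take hu)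
    rw [lev_sig hh h2]
    have h1 := hmax j hj
    have hD : lev (pivot h) = 2 * (pivot h).2.1 := by
      rcases hp : pivot h with ⟨p, b, c⟩
      rw [hp] at hcF
      simp only at hcF; subst hcF; simp [lev, bit]
    omega
  · have e : M.getLast? = some (sig h hvOrigin) := by
      rw [hM, List.getLast?_map, List.getLast?_reverse, List.head?_take, if_neg (by omega), hh0, Option.map_some]
    rw [List.getLast?_eq_some_getLast hMne, Option.some_inj] at e
    rw [e, lev_sig hh h2, lev_hvOrigin]
    have hT' : ((tOf h : ℕ) : ℤ) = (pivot h).2.1 + 1 := by simp [tOf, Int.toNat_of_nonneg hb0]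
    rw [hT']; ring

end CutC

/-! ### D1, Step C (continued): weights, injectivity per class, the class sums, and `HalfPlaneCut` -/

section CutD

variable {T L : ℕ} {h : List HV}

/-- Bridge weight in `S_{T'}`: `x^{|B|} y^{#top-level vertices}` (the summand of `stripGFxy_beta_eq`). [cite: BeatonBousquetMelouDeGierDuminilCopinGuttmann2014, §3.2, above Corollary 8 (arXiv v5 p. 12: "the analogous series A_T(x;y) and B_T(x;y) that count arches and bridges")] -/
def bWt (T' : ℕ) (x y : ℝ) (B : List HV) : ℝ := x ^ B.length * y ^ (B.filter fun v => lev v = 2 * (T' : ℤ) - 1).length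

/-- `bWt ≥ 0` (nonnegative coefficients). [cite: BeatonBousquetMelouDeGierDuminilCopinGuttmann2014, §3.2, above Corollary 8 (arXiv v5 p. 12: "the analogous series A_T(x;y) and B_T(x;y) that count arches and bridges")] -/
theorem bWt_nonneg (T' : ℕ) {x y : ℝ} (hx : 0 ≤ x) (hy : 0 ≤ y) (B : List HV) : 0 ≤ bWt T' x y B :=
  mul_nonneg (pow_nonneg hx _) (pow_nonneg hy _)

/-- `|pad| ≤ 1` (the parity pad is at most one vertex). [cite: DuminilCopinSmirnov2012, §3, proof of Theorem 1 (bridge decomposition at the last extremal vertex, arXiv PDF p. 8)] -/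
theorem length_padOf_le (h : List HV) : (padOf h).length ≤ 1 := by
  rw [padOf]; split <;> simp

/-- `|B₁| + |B₃| = |h| + 1 + 2|pad|` (the pivot is shared; each piece carries the pad). [cite: DuminilCopinSmirnov2012, §3] -/
theorem length_B1_add_B3 (hh : h ∈ (hpLists T L).image hdP) (h2 : 2 ≤ h.length) :
    (B1 h).length + (B3 h).length = h.length + 1 + 2 * (padOf h).length := by
  obtain ⟨hq, -⟩ := pivot_facts hh h2
  simp only [B1, B3, List.length_append, List.length_map, List.length_reverse, List.length_take, List.length_drop,
    Nat.min_eq_left (Nat.succ_le_of_lt hq)]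
  omega

/-- The pad has no top-level vertex (level `0 ≠ 2T'−1` by parity). [cite: DuminilCopinSmirnov2012, §3, proof of Theorem 1 (bridge decomposition at the last extremal vertex, arXiv PDF p. 8)] -/
theorem topCount_padOf (h : List HV) (T' : ℕ) :
    ((padOf h).filter fun v => lev v = 2 * (T' : ℤ) - 1).length = 0 := by
  rw [padOf]
  split
  · rfl
  · have : ¬ ((0 : ℤ) = 2 * (T' : ℤ) - 1) := by omega
    simp [lev_hvOrigin, this]

/-- The reflection turns surface vertices into top-level vertices, count for count. [cite: BeatonBousquetMelouDeGierDuminilCopinGuttmann2014, Prop. 6] -/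
theorem topCount_map_sig (hh : h ∈ (hpLists T L).image hdP) (h2 : 2 ≤ h.length) (M : List HV) :
    ((M.map (sig h)).filter fun v => lev v = 2 * (tOf h : ℤ) - 1).length = (M.filter fun v => lev v = 0).length := by
  obtain ⟨-, -, -, hb0, -⟩ := pivot_facts hh h2
  have hT' : ((tOf h : ℕ) : ℤ) = (pivot h).2.1 + 1 := by simp [tOf, Int.toNat_of_nonneg hb0]
  rw [List.filter_map, List.length_map]
  congr 1
  refine List.filter_congr fun v _ => ?_
  simp only [Function.comp_apply, lev_sig hh h2, decide_eq_decide, hT']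
  omega

/-- **Surface counts add**: `#top(B₁) + #top(B₃) = #₀(h)` (the shared pivot is not on the surface). [cite: BeatonBousquetMelouDeGierDuminilCopinGuttmann2014, §4.5 (arXiv v5 p. 15: "By looking at its last contact, one can factor the arch into two bridges", Fig. 11, eq. (20))] -/
theorem topCount_B1_add_B3 (hh : h ∈ (hpLists T L).image hdP) (h2 : 2 ≤ h.length) :
    ((B1 h).filter fun v => lev v = 2 * (tOf h : ℤ) - 1).length +
        ((B3 h).filter fun v => lev v = 2 * (tOf h : ℤ) - 1).length = (h.filter fun v => lev v = 0).length := by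
  obtain ⟨hq, hpiv, -, -, -, hD1, -, -⟩ := pivot_facts hh h2
  rw [B1, B3, List.filter_append, List.filter_append, List.length_append, List.length_append,
    topCount_padOf h (tOf h), topCount_map_sig hh h2, topCount_map_sig hh h2, List.filter_reverse,
    List.length_reverse, zero_add, zero_add]
  have hdrop : h.drop (lastArgmax h) = h[lastArgmax h] :: h.drop (lastArgmax h + 1) := List.drop_eq_getElem_cons hq
  have hnot : ¬ (lev h[lastArgmax h] = 0) := by rw [← hpiv]; omega
  rw [hdrop, List.filter_cons_of_neg (by simpa using hnot)]
  conv_rhs => rw [← List.take_append_drop (lastArgmax h + 1) h]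
  rw [List.filter_append, List.length_append]

/-- **Weight comparison**: `wt(h) ≤ x⁻³ · bWt(B₁) · bWt(B₃)` for `0 < x ≤ 1` (at most three extra vertices: the shared pivot and the
two pads). [cite: BeatonBousquetMelouDeGierDuminilCopinGuttmann2014, §4.5 (arXiv v5 p. 15: "By looking at its last contact, one can factor the arch into two bridges", Fig. 11, eq. (20))] -/
theorem listWt_le_bWt (hh : h ∈ (hpLists T L).image hdP) (h2 : 2 ≤ h.length) {x y : ℝ} (hx0 : 0 < x) (hx1 : x ≤ 1)
    (hy : 0 ≤ y) : listWt x y h ≤ x⁻¹ ^ 3 * (bWt (tOf h) x y (B1 h) * bWt (tOf h) x y (B3 h)) := by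
  have hlen := length_B1_add_B3 hh h2
  have hpad := length_padOf_le h
  have htop := topCount_B1_add_B3 hh h2
  set k := (padOf h).length with hk
  set t1 := ((B1 h).filter fun v => lev v = 2 * (tOf h : ℤ) - 1).length
  set t3 := ((B3 h).filter fun v => lev v = 2 * (tOf h : ℤ) - 1).length
  set t0 := (h.filter fun v => lev v = 0).length
  rw [listWt, bWt, bWt]
  have ey : y ^ t1 * y ^ t3 = y ^ t0 := by rw [← pow_add, htop]
  have hx : x ^ h.length ≤ x⁻¹ ^ 3 * (x ^ (B1 h).length * x ^ (B3 h).length) := by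
    rw [← pow_add, hlen]
    have h3 : x ^ 3 ≤ x ^ (1 + 2 * k) := pow_le_pow_of_le_one hx0.le hx1 (by omega)
    have e1 : x ^ 3 * x⁻¹ ^ 3 = 1 := by rw [← mul_pow, mul_inv_cancel₀ hx0.ne', one_pow]
    calc x ^ h.length = x ^ h.length * (x ^ 3 * x⁻¹ ^ 3) := by rw [e1, mul_one]
      _ ≤ x ^ h.length * (x ^ (1 + 2 * k) * x⁻¹ ^ 3) :=
          mul_le_mul_of_nonneg_left (mul_le_mul_of_nonneg_right h3 (pow_nonneg (inv_nonneg.2 hx0.le) _)) (pow_nonneg hx0.le _)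
      _ = x⁻¹ ^ 3 * x ^ (h.length + 1 + 2 * k) := by rw [show h.length + 1 + 2 * k = h.length + (1 + 2 * k) by ring, pow_add]; ring
  calc x ^ h.length * y ^ t0 ≤ x⁻¹ ^ 3 * (x ^ (B1 h).length * x ^ (B3 h).length) * y ^ t0 :=
        mul_le_mul_of_nonneg_right hx (pow_nonneg hy _)
    _ = x⁻¹ ^ 3 * (x ^ (B1 h).length * y ^ t1 * (x ^ (B3 h).length * y ^ t3)) := by rw [← ey]; ring

/-- **Injectivity per class**: on heads of a fixed class `(T', parity)` the map `h ↦ (B₁ h, B₃ h)` is injective (the pivot abscissa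
is read off `B₁`'s last vertex `σ(O)`; then un-reflect and re-glue at the pivot). [cite: DuminilCopinSmirnov2012, §3 (the decomposition is reversible)] -/
theorem B_inj {h₁ h₂ : List HV} (hh₁ : h₁ ∈ (hpLists T L).image hdP) (h2₁ : 2 ≤ h₁.length)
    (hh₂ : h₂ ∈ (hpLists T L).image hdP) (h2₂ : 2 ≤ h₂.length) (hcls : cls h₁ = cls h₂)
    (e1 : B1 h₁ = B1 h₂) (e3 : B3 h₁ = B3 h₂) : h₁ = h₂ := by
  obtain ⟨-, hh0₁, -, -, hne₁, -⟩ := of_mem_heads hh₁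
  obtain ⟨-, hh0₂, -, -, hne₂, -⟩ := of_mem_heads hh₂
  obtain ⟨hq₁, -⟩ := pivot_facts hh₁ h2₁
  obtain ⟨hq₂, -⟩ := pivot_facts hh₂ h2₂
  rw [cls, cls, Prod.mk.injEq] at hcls
  have ht : tOf h₁ = tOf h₂ := hcls.1
  have hc : (pivot h₁).2.2 = (pivot h₂).2.2 := hcls.2
  have hpad : padOf h₁ = padOf h₂ := by rw [padOf, padOf, hc]
  rw [B1, B1, hpad] at e1
  rw [B3, B3, hpad] at e3
  have e1' := List.append_cancel_left e1
  have e3' := List.append_cancel_left e3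
  have gl : ∀ {g : List HV} (hg0 : g.head? = some hvOrigin) (hq : lastArgmax g < g.length),
      (((g.take (lastArgmax g + 1)).reverse).map (sig g)).getLast? = some (sig g hvOrigin) := by
    intro g hg0 hq
    rw [List.getLast?_map, List.getLast?_reverse, List.head?_take, if_neg (by omega), hg0, Option.map_some]
  have hp : (pivot h₁).1 = (pivot h₂).1 := by
    have := congrArg List.getLast? e1'
    rw [gl hh0₁ hq₁, gl hh0₂ hq₂, Option.some_inj, sig, sig, sigmaT_apply, sigmaT_apply, Prod.mk.injEq] at this
    simpa using this.1
  have hsig : sig h₁ = sig h₂ := by rw [sig, sig, ht, hp]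
  rw [hsig] at e1' e3'
  have t₁ := List.reverse_inj.1 ((List.map_injective_iff.2 (sig h₂).injective) e1')
  have d₁ := (List.map_injective_iff.2 (sig h₂).injective) e3'
  calc h₁ = h₁.take (lastArgmax h₁ + 1) ++ h₁.drop (lastArgmax h₁ + 1) := (List.take_append_drop _ _).symm
    _ = h₁.take (lastArgmax h₁ + 1) ++ (h₁.drop (lastArgmax h₁)).tail := by rw [List.tail_drop]
    _ = h₂.take (lastArgmax h₂ + 1) ++ (h₂.drop (lastArgmax h₂)).tail := by rw [t₁, d₁]
    _ = h₂ := by rw [List.tail_drop, List.take_append_drop]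

/-- `Σ_{bridges} bWt = B_{T',L'}(x; y)`. [cite: DuminilCopinSmirnov2012, §3] -/
theorem sum_bWt_eq {T' L' : ℕ} (hT' : 1 ≤ T') (x y : ℝ) :
    ∑ B ∈ bridgeLists T' L', bWt T' x y B = stripGFxy T' L' (IsBetaDart T') x y := (stripGFxy_beta_eq hT' x y).symm

/-- **The class sum**: heads of class `(T', e)` weigh at most `x⁻³ B_{T',2L+T}(x; y)² ≤ x⁻³ b(T')²`.
[cite: BeatonBousquetMelouDeGierDuminilCopinGuttmann2014, §4.5, eq. (20) (arXiv v5 p. 15); DuminilCopinSmirnov2012, §3 (A_{T+1} − A_T ≤ x B_{T+1}²); GlazmanManolescu2019, §5.4, proof of Theorem 3 (arXiv v3 pp. 23–24)] -/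
theorem sum_class_le {x y : ℝ} (hx0 : 0 < x) (hx1 : x ≤ 1) (hy : 0 ≤ y) (b : ℕ → ℝ)
    (hb : ∀ T' L' : ℕ, 1 ≤ T' → stripGFxy T' L' (IsBetaDart T') x y ≤ b T') (c : ℕ × Bool) :
    ∑ h ∈ ((hpLists T L).image hdP).filter (fun h => 2 ≤ h.length ∧ cls h = c), listWt x y h
      ≤ x⁻¹ ^ 3 * (b c.1 * b c.1) := by
  classical
  set S := ((hpLists T L).image hdP).filter (fun h => 2 ≤ h.length ∧ cls h = c) with hS
  set bL := bridgeLists c.1 (2 * L + T) with hbL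
  have hx3 : 0 ≤ x⁻¹ ^ 3 := pow_nonneg (inv_nonneg.2 hx0.le) _
  rcases S.eq_empty_or_nonempty with hSe | ⟨h₀, hh₀⟩
  · rw [hSe, sum_empty]; exact mul_nonneg hx3 (mul_self_nonneg _)
  obtain ⟨hh₀', h2₀, hc₀⟩ := mem_filter.1 hh₀
  have hT' : 1 ≤ c.1 := by rw [← hc₀]; exact one_le_tOf h₀
  have hmemS : ∀ h ∈ S, h ∈ (hpLists T L).image hdP ∧ 2 ≤ h.length ∧ tOf h = c.1 ∧ cls h = c := by
    intro h hh
    obtain ⟨hh', h2, hc⟩ := mem_filter.1 hh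
    exact ⟨hh', h2, by rw [← hc]; rfl, hc⟩
  set g : List HV × List HV → ℝ := fun uv => bWt c.1 x y uv.1 * bWt c.1 x y uv.2 with hg
  calc ∑ h ∈ S, listWt x y h
      ≤ ∑ h ∈ S, x⁻¹ ^ 3 * g (B1 h, B3 h) := by
        refine sum_le_sum fun h hh => ?_
        obtain ⟨hh', h2, ht, -⟩ := hmemS h hh
        have := listWt_le_bWt hh' h2 hx0 hx1 hy
        rw [ht] at this
        exact this
    _ = x⁻¹ ^ 3 * ∑ h ∈ S, g (B1 h, B3 h) := by rw [mul_sum]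
    _ ≤ x⁻¹ ^ 3 * ∑ uv ∈ bL ×ˢ bL, g uv := by
        refine mul_le_mul_of_nonneg_left ?_ hx3
        refine sum_le_sum_of_injOn_of_nonneg (fun h => (B1 h, B3 h)) ?_ ?_ g fun uv _ =>
          mul_nonneg (bWt_nonneg _ hx0.le hy _) (bWt_nonneg _ hx0.le hy _)
        · intro h₁ hh₁ h₂ hh₂ e
          rw [Finset.mem_coe] at hh₁ hh₂
          obtain ⟨hh₁', h2₁, -, hc₁⟩ := hmemS h₁ hh₁
          obtain ⟨hh₂', h2₂, -, hc₂⟩ := hmemS h₂ hh₂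
          rw [Prod.mk.injEq] at e
          exact B_inj hh₁' h2₁ hh₂' h2₂ (by rw [hc₁, hc₂]) e.1 e.2
        · intro h hh
          obtain ⟨hh', h2, ht, -⟩ := hmemS h hh
          rw [mem_product]
          exact ⟨by rw [hbL, ← ht]; exact B1_mem hh' h2, by rw [hbL, ← ht]; exact B3_mem hh' h2⟩
    _ = x⁻¹ ^ 3 * (stripGFxy c.1 (2 * L + T) (IsBetaDart c.1) x y * stripGFxy c.1 (2 * L + T) (IsBetaDart c.1) x y) := by
        rw [sum_product, ← sum_bWt_eq hT', sum_mul_sum]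
    _ ≤ x⁻¹ ^ 3 * (b c.1 * b c.1) := by
        refine mul_le_mul_of_nonneg_left (mul_self_le_mul_self ?_ (hb _ _ hT')) hx3
        rw [← sum_bWt_eq hT']
        exact sum_nonneg fun B _ => bWt_nonneg _ hx0.le hy _

/-- **Step C**: `Σ_{heads} wt ≤ x y + 2 x⁻³ Σ_{T'=1}^{T} b(T')²` — the head `[O]` weighs `xy`; every other head is cut at its last
deepest vertex into two bridges of some `S_{T'}`, `1 ≤ T' ≤ T`, two parity classes per `T'`.
[cite: BeatonBousquetMelouDeGierDuminilCopinGuttmann2014, §4.5 (arXiv v5 p. 15: "By looking at its last contact, one can factor the arch into two bridges", Fig. 11, eq. (20)); DuminilCopinSmirnov2012, §3 (proof of Theorem 1, arXiv PDF p. 8)] -/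
theorem sum_heads_le {x y : ℝ} (hx0 : 0 < x) (hx1 : x ≤ 1) (hy : 0 ≤ y) (b : ℕ → ℝ)
    (hb : ∀ T' L' : ℕ, 1 ≤ T' → stripGFxy T' L' (IsBetaDart T') x y ≤ b T') :
    ∑ h ∈ (hpLists T L).image hdP, listWt x y h ≤ x * y + 2 * x⁻¹ ^ 3 * ∑ T' ∈ Icc 1 T, b T' * b T' := by
  classical
  set Hs := (hpLists T L).image hdP with hHs
  rw [← sum_filter_add_sum_filter_not Hs (fun h => 2 ≤ h.length)]
  have h1 : ∑ h ∈ Hs.filter (fun h => ¬ 2 ≤ h.length), listWt x y h ≤ x * y := by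
    have hsub : Hs.filter (fun h => ¬ 2 ≤ h.length) ⊆ {[hvOrigin]} := by
      intro h hh
      obtain ⟨hh', hlt⟩ := mem_filter.1 hh
      obtain ⟨-, hh0, -, -, hne, -⟩ := of_mem_heads hh'
      rw [mem_singleton]
      obtain ⟨a, l', rfl⟩ := List.exists_cons_of_ne_nil hne
      have : l' = [] := by
        rcases l' with _ | ⟨b', l''⟩
        · rfl
        · simp at hlt
      subst this
      simpa using hh0
    refine (sum_le_sum_of_subset_of_nonneg hsub fun h _ _ => listWt_nonneg hx0.le hy h).trans ?_
    rw [sum_singleton, listWt]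
    simp [lev_hvOrigin]
  have h2 : ∑ h ∈ Hs.filter (fun h => 2 ≤ h.length), listWt x y h ≤ 2 * x⁻¹ ^ 3 * ∑ T' ∈ Icc 1 T, b T' * b T' := by
    have hmaps : ∀ h ∈ Hs.filter (fun h => 2 ≤ h.length), cls h ∈ Icc 1 T ×ˢ (univ : Finset Bool) := by
      intro h hh
      obtain ⟨hh', h2⟩ := mem_filter.1 hh
      obtain ⟨-, -, -, hb0, hbT, -⟩ := pivot_facts hh' h2
      rw [mem_product, mem_Icc, cls]
      refine ⟨⟨one_le_tOf h, ?_⟩, mem_univ _⟩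
      have : ((tOf h : ℕ) : ℤ) = (pivot h).2.1 + 1 := by simp [tOf, Int.toNat_of_nonneg hb0]
      omega
    rw [← sum_fiberwise_of_maps_to hmaps]
    calc ∑ c ∈ Icc 1 T ×ˢ (univ : Finset Bool), ∑ h ∈ (Hs.filter fun h => 2 ≤ h.length) with cls h = c, listWt x y h
        ≤ ∑ c ∈ Icc 1 T ×ˢ (univ : Finset Bool), x⁻¹ ^ 3 * (b c.1 * b c.1) := by
          refine sum_le_sum fun c _ => ?_
          rw [filter_filter]
          exact sum_class_le hx0 hx1 hy b hb c
      _ = 2 * x⁻¹ ^ 3 * ∑ T' ∈ Icc 1 T, b T' * b T' := by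
          rw [sum_product, mul_sum]
          refine sum_congr rfl fun T' _ => ?_
          simp only [Fintype.sum_bool]
          ring
  linarith

end CutD

/-- **D1 `HalfPlaneCut` HOLDS** (the two-cut decomposition, with the refute-first corrections R1–R3: parity pad, free final half-edge,
two cuts): `C^+_{T,L}(x,y) ≤ 1 + (2 + 4 Z)(x y + 2 x⁻³ Σ_{T' ≤ T} b(T')²)`.
[cite: BeatonBousquetMelouDeGierDuminilCopinGuttmann2014, §4.2 (arXiv v5 p. 14: the desorbed conclusion y* ≤ y_c) and §4.5 (p. 15: the last-contact factorisation); DuminilCopinSmirnov2012, §3, proof of Theorem 1 (bridge decomposition, arXiv PDF p. 8); MadrasSlade1993, §3.1 (pp. 57–59); HammersleyWelsh1962] -/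
theorem halfPlaneCut_holds : HalfPlaneCut := by
  intro x y hx0 hx1 hy b c z hb hc hz T L
  have hz0 : 0 ≤ z := by simpa using hz 0
  have hA := hpGF_le_sum_hpLists (T := T) (L := L) hx0.le hy
  have hB := sum_hpLists_le_heads (T := T) (L := L) hx0.le hy c z hc hz
  have hC := sum_heads_le (T := T) (L := L) hx0 hx1 hy b hb
  have hH : 0 ≤ ∑ h ∈ (hpLists T L).image hdP, listWt x y h := sum_nonneg fun h _ => listWt_nonneg hx0.le hy h
  have hQ : 0 ≤ x * y + 2 * x⁻¹ ^ 3 * ∑ T' ∈ Icc 1 T, b T' * b T' :=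
    add_nonneg (mul_nonneg hx0.le hy) (mul_nonneg (mul_nonneg (by norm_num) (pow_nonneg (inv_nonneg.2 hx0.le) _))
      (sum_nonneg fun T' _ => mul_self_nonneg _))
  have hxz : x * z ≤ z := by nlinarith
  have h12 : 0 ≤ 1 + 2 * x * z := by nlinarith
  calc hpGF T L x y ≤ 1 + 2 * ∑ l ∈ hpLists T L, listWt x y l := hA
    _ ≤ 1 + 2 * ((1 + 2 * x * z) * ∑ h ∈ (hpLists T L).image hdP, listWt x y h) := by linarith
    _ ≤ 1 + 2 * ((1 + 2 * x * z) * (x * y + 2 * x⁻¹ ^ 3 * ∑ T' ∈ Icc 1 T, b T' * b T')) := by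
        have := mul_le_mul_of_nonneg_left hC h12
        linarith
    _ ≤ 1 + (2 + 4 * z) * (x * y + 2 * x⁻¹ ^ 3 * ∑ T' ∈ Icc 1 T, b T' * b T') := by
        have : 2 * (1 + 2 * x * z) ≤ 2 + 4 * z := by linarith
        nlinarith

end YcCut

/-- **D1 `HalfPlaneCut` HOLDS** (re-export of `YcCut.halfPlaneCut_holds` at the level of the vocabulary).
[cite: BeatonBousquetMelouDeGierDuminilCopinGuttmann2014, §4.2 (arXiv v5 p. 14) and §4.5 (p. 15: the last-contact factorisation); GlazmanManolescu2019, §5.4, proof of Theorem 3 (arXiv v3 pp. 23–24); DuminilCopinSmirnov2012, §3, proof of Theorem 1 (arXiv PDF p. 8); HammersleyWelsh1962] -/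
theorem halfPlaneCut_holds : HalfPlaneCut := YcCut.halfPlaneCut_holds

end Literature.Probability.RandomPlanarGeometry.SAW.HV
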